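import Mathlib
import HarnessLib
import Summits.NavierStokesRegularity.NavierStokesRegularity.Theorems.PoloidalWindowDoorPoloidalWindowRigidityUntwistedBracket
import Summits.NavierStokesRegularity.NavierStokesRegularity.Theorems.PoloidalWindowDoorPoloidalWindowRigidityUntwistedLogDerivatives

/-!
# Route `PoloidalWindowDoor`, crux `PoloidalWindowRigidity` (K2, stmt-NavierStokesRegularity-19708), skeleton `lrc-jet` v5,
# stub `stub_untwisted` — brick F4-tr-d (part 1): THE VERTICAL COORDINATE PLANE OF THE BRANCH-2b REGION
# (the two scalar fields `Qu = Λ·∂_b w` and `H = (1−Λ)·∂_b w`, their vertical logarithmic derivatives `η`, `ξ`, and the separation `Qu = d(z)θ(t)`)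

Cell ns-regularity-ideate, K2 lead ns-poloidal-K2-p1 (gen 6; `--supports stmt-NavierStokesRegularity-19708`, helper; BRIEF-v5-bricks-v2 (S4)).

Setting (one slice): `w : ℝ³ → ℝ` untwisted on an open `U` (`∂₂w = P(w,y₂)`), slope structure function `Λ(w,y₂)`, a point `y₀ ∈ U` and a horizontal index
`b` with `∂_b w ≠ 0` and `Λ ∉ {0,1}` on `U`.  Along the vertical coordinate plane `Y(t,z) = y₀ + t e_b + (z − (y₀)₂) e₂` consider
  `Qu(t,z) := Λ(p)·∂_b w(Y)`  and  `H(t,z) := (1 − Λ(p))·∂_b w(Y)`,  `p = (w(Y), z)`.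
* `hasDerivAt_hline`, `hline_vline` — calculus of the plane map (`∂_t Y = e_b`, `∂_z Y = e₂`, heights and feet);
* `vert_deriv_Qu`, `vert_deriv_H` — **`∂_z Qu = η(p)·Qu`, `∂_z H = ξ(p)·H`** with `η = Pw + Ld/Λ`, `ξ = Pw − Ld/(1−Λ)` (`Ld = DΛ(p)(P,1)`), from the tree's
  `fderiv_vert_hpartial` (p548007) and the leaf chain rule;
* `horiz_deriv_leaf` — `∂_t g(p(t,z)) = g_w(p)·∂_b w(Y)` for a leafwise `g` (1-D chain rule);
* `hasDerivAt_eta_t_zero` — on the Branch-2b region (`D₁ = 0`, brick F3a's Wronskian) `t ↦ η(p(t,z))` has zero derivative (`∂_w η = D₁/Λ²`, brick F4-tr-c);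
* `eq_of_hasDerivAt_zero` — one-variable constancy from a vanishing derivative on a segment.
The sequel (part 2) performs the separation `Qu(t,z)·Qu(0,z₀) = Qu(t,z₀)·Qu(0,z)` (brick F4-tr-b), derives the hypotheses (α), (β) of
`…UntwistedStuartBranch.stuartBranch_false`, and concludes that the Branch-2b region is empty.

WHAT THIS IS NOT: not a claim about Navier–Stokes — calculus bookkeeping (bears_on LADDER-NS N0 via crux K2 = stmt-19708).
-/

noncomputable section

-- the summit and its single sub-problem share the name (CONVENTIONS §1), as in every Theorems file
set_option linter.dupNamespace false

namespace Summit.NavierStokesRegularity.NavierStokesRegularity.Theorems.PoloidalWindowDoorPoloidalWindowRigidityUntwistedStuartTranslation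

open Set Function Filter Topology Metric
open Summit.NavierStokesRegularity.NavierStokesRegularity.Theorems.PoloidalWindowDoorPoloidalWindowRigidityConstantShearMeans
open Summit.NavierStokesRegularity.NavierStokesRegularity.Theorems.PoloidalWindowDoorLrcModEntireLeafwiseVertical
open Summit.NavierStokesRegularity.NavierStokesRegularity.Theorems.PoloidalWindowDoorPoloidalWindowRigidityUntwistedSeparation
open Summit.NavierStokesRegularity.NavierStokesRegularity.Theorems.PoloidalWindowDoorPoloidalWindowRigidityUntwistedBracket
open Summit.NavierStokesRegularity.NavierStokesRegularity.Theorems.PoloidalWindowDoorPoloidalWindowRigidityUntwistedLogDerivatives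

/-! ### §A  The plane map -/

/-- **Derivative along a horizontal line**: for `g` differentiable at the point, `t ↦ g(y + t e_b)` has derivative `∂_b g` there. [folklore] -/
theorem hasDerivAt_hline {g : EuclideanSpace ℝ (Fin 3) → ℝ} (y : EuclideanSpace ℝ (Fin 3)) (b : Fin 3) {t : ℝ}
    (hg : DifferentiableAt ℝ g (y + t • EuclideanSpace.single b (1 : ℝ))) :
    HasDerivAt (fun t' : ℝ => g (y + t' • EuclideanSpace.single b (1 : ℝ)))
      (fderiv ℝ g (y + t • EuclideanSpace.single b (1 : ℝ)) (EuclideanSpace.single b (1 : ℝ))) t := by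
  have hline : HasDerivAt (fun t' : ℝ => y + t' • EuclideanSpace.single b (1 : ℝ)) (EuclideanSpace.single b (1 : ℝ)) t := by
    simpa using ((hasDerivAt_id t).smul_const (EuclideanSpace.single b (1 : ℝ))).const_add y
  exact hg.hasFDerivAt.comp_hasDerivAt t hline

/-- Heights on the plane: `(y₀ + t e_b + (z − (y₀)₂) e₂)₂ = z` for a horizontal `b`. [folklore] -/
theorem plane_apply_two (y₀ : EuclideanSpace ℝ (Fin 3)) {b : Fin 3} (hb : b ≠ 2) (t z : ℝ) :
    (y₀ + t • EuclideanSpace.single b (1 : ℝ) + (z - y₀ 2) • EuclideanSpace.single (2 : Fin 3) (1 : ℝ)) 2 = z := by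
  simp [hb]

/-- The foot `y₀ + t e_b` has the height of `y₀`. [folklore] -/
theorem foot_apply_two (y₀ : EuclideanSpace ℝ (Fin 3)) {b : Fin 3} (hb : b ≠ 2) (t : ℝ) :
    (y₀ + t • EuclideanSpace.single b (1 : ℝ)) 2 = y₀ 2 := by
  simp [hb]

/-- The plane point as a point of the vertical line through its foot: `y₀ + t e_b + (z − (y₀)₂)e₂ = y₁ + (z − (y₁)₂) e₂`, `y₁ = y₀ + t e_b`. [folklore] -/
theorem plane_eq_vline (y₀ : EuclideanSpace ℝ (Fin 3)) {b : Fin 3} (hb : b ≠ 2) (t z : ℝ) :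
    y₀ + t • EuclideanSpace.single b (1 : ℝ) + (z - y₀ 2) • EuclideanSpace.single (2 : Fin 3) (1 : ℝ) =
      (y₀ + t • EuclideanSpace.single b (1 : ℝ)) +
        (z - (y₀ + t • EuclideanSpace.single b (1 : ℝ)) 2) • EuclideanSpace.single (2 : Fin 3) (1 : ℝ) := by
  rw [foot_apply_two y₀ hb t]

/-- The plane point as a point of the horizontal line through `y₀ + (z − (y₀)₂)e₂`. [folklore] -/
theorem plane_eq_hline (y₀ : EuclideanSpace ℝ (Fin 3)) (b : Fin 3) (t z : ℝ) :
    y₀ + t • EuclideanSpace.single b (1 : ℝ) + (z - y₀ 2) • EuclideanSpace.single (2 : Fin 3) (1 : ℝ) =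
      (y₀ + (z - y₀ 2) • EuclideanSpace.single (2 : Fin 3) (1 : ℝ)) + t • EuclideanSpace.single b (1 : ℝ) := by
  abel

/-- A small plane patch lies in an open set: if `y₀ ∈ U` open, there is `ρ > 0` with `y₀ + t e_b + (z − (y₀)₂)e₂ ∈ U` whenever `|t| < ρ`, `|z − (y₀)₂| < ρ`.
[folklore] -/
theorem exists_plane_patch {U : Set (EuclideanSpace ℝ (Fin 3))} (hU : IsOpen U) {y₀ : EuclideanSpace ℝ (Fin 3)} (hy₀ : y₀ ∈ U) (b : Fin 3) :
    ∃ ρ > 0, ∀ t z : ℝ, |t| < ρ → |z - y₀ 2| < ρ →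
      y₀ + t • EuclideanSpace.single b (1 : ℝ) + (z - y₀ 2) • EuclideanSpace.single (2 : Fin 3) (1 : ℝ) ∈ U := by
  obtain ⟨ε, hε, hball⟩ := Metric.isOpen_iff.mp hU y₀ hy₀
  refine ⟨ε / 2, by positivity, fun t z ht hz => hball ?_⟩
  rw [Metric.mem_ball, dist_eq_norm]
  have e : y₀ + t • EuclideanSpace.single b (1 : ℝ) + (z - y₀ 2) • EuclideanSpace.single (2 : Fin 3) (1 : ℝ) - y₀ =
      t • EuclideanSpace.single b (1 : ℝ) + (z - y₀ 2) • EuclideanSpace.single (2 : Fin 3) (1 : ℝ) := by abel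
  rw [e]
  calc ‖t • EuclideanSpace.single b (1 : ℝ) + (z - y₀ 2) • EuclideanSpace.single (2 : Fin 3) (1 : ℝ)‖
      ≤ ‖t • EuclideanSpace.single b (1 : ℝ)‖ + ‖(z - y₀ 2) • EuclideanSpace.single (2 : Fin 3) (1 : ℝ)‖ := norm_add_le _ _
    _ = |t| + |z - y₀ 2| := by simp [norm_smul]
    _ < ε / 2 + ε / 2 := add_lt_add ht hz
    _ = ε := by ring

/-! ### §B  The two scalar fields and their vertical logarithmic derivatives (pointwise on `U`) -/

section Fields

variable {w : EuclideanSpace ℝ (Fin 3) → ℝ} {P Λ : ℝ × ℝ → ℝ} {U : Set (EuclideanSpace ℝ (Fin 3))}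

/-- **`∂₂(Λ(w,y₂)·∂_b w) = (Ld + Λ·Pw)·∂_b w`** on the untwisted set (`Ld = DΛ(p)(P(p),1)`): the vertical derivative of the vertical shear
`Qu = Λ∂_b w` is `η·Qu`, `η = Pw + Ld/Λ`. [folklore] -/
theorem fderiv_vert_Qu (hU : IsOpen U) (hw : ContDiff ℝ 2 w)
    (hPd : ∀ y ∈ U, DifferentiableAt ℝ P (w y, y 2)) (hΛd : ∀ y ∈ U, DifferentiableAt ℝ Λ (w y, y 2))
    (hP : ∀ y ∈ U, fderiv ℝ w y (EuclideanSpace.single 2 (1 : ℝ)) = P (w y, y 2)) {y : EuclideanSpace ℝ (Fin 3)} (hy : y ∈ U)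
    {b : Fin 3} (hb : b ≠ 2) :
    fderiv ℝ (fun y' => Λ (w y', y' 2) * fderiv ℝ w y' (EuclideanSpace.single b (1 : ℝ))) y (EuclideanSpace.single 2 (1 : ℝ)) =
      (fderiv ℝ Λ (w y, y 2) (P (w y, y 2), 1) + Λ (w y, y 2) * fderiv ℝ P (w y, y 2) (1, 0)) *
        fderiv ℝ w y (EuclideanSpace.single b (1 : ℝ)) := by
  have hwd : Differentiable ℝ w := hw.differentiable (by norm_num)
  have hL : DifferentiableAt ℝ (fun y' : EuclideanSpace ℝ (Fin 3) => Λ (w y', y' 2)) y := differentiableAt_leaf_comp (hΛd y hy) (hwd y)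
  rw [fderiv_mul_apply hL (differentiableAt_partial hw _ y), fderiv_vert_hpartial hU hw hPd hP hy hb,
    fderiv_leaf_comp_vertical (hΛd y hy) (hwd y), hP y hy]
  ring

/-- **`∂₂((1 − Λ(w,y₂))·∂_b w) = (−Ld + (1−Λ)·Pw)·∂_b w`**: the vertical derivative of `H = (1−Λ)∂_b w` is `ξ·H`, `ξ = Pw − Ld/(1−Λ)`. [folklore] -/
theorem fderiv_vert_H (hU : IsOpen U) (hw : ContDiff ℝ 2 w)
    (hPd : ∀ y ∈ U, DifferentiableAt ℝ P (w y, y 2)) (hΛd : ∀ y ∈ U, DifferentiableAt ℝ Λ (w y, y 2))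
    (hP : ∀ y ∈ U, fderiv ℝ w y (EuclideanSpace.single 2 (1 : ℝ)) = P (w y, y 2)) {y : EuclideanSpace ℝ (Fin 3)} (hy : y ∈ U)
    {b : Fin 3} (hb : b ≠ 2) :
    fderiv ℝ (fun y' => (1 - Λ (w y', y' 2)) * fderiv ℝ w y' (EuclideanSpace.single b (1 : ℝ))) y (EuclideanSpace.single 2 (1 : ℝ)) =
      (-(fderiv ℝ Λ (w y, y 2) (P (w y, y 2), 1)) + (1 - Λ (w y, y 2)) * fderiv ℝ P (w y, y 2) (1, 0)) *
        fderiv ℝ w y (EuclideanSpace.single b (1 : ℝ)) := by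
  have hwd : Differentiable ℝ w := hw.differentiable (by norm_num)
  have hL : DifferentiableAt ℝ (fun y' : EuclideanSpace ℝ (Fin 3) => Λ (w y', y' 2)) y := differentiableAt_leaf_comp (hΛd y hy) (hwd y)
  have h1L : DifferentiableAt ℝ (fun y' : EuclideanSpace ℝ (Fin 3) => 1 - Λ (w y', y' 2)) y := (differentiableAt_const _).sub hL
  have hL' : fderiv ℝ (fun y' : EuclideanSpace ℝ (Fin 3) => 1 - Λ (w y', y' 2)) y (EuclideanSpace.single 2 (1 : ℝ)) =
      -(fderiv ℝ Λ (w y, y 2) (P (w y, y 2), 1)) := by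
    rw [fderiv_const_sub, neg_apply, fderiv_leaf_comp_vertical (hΛd y hy) (hwd y), hP y hy]
  rw [fderiv_mul_apply h1L (differentiableAt_partial hw _ y), fderiv_vert_hpartial hU hw hPd hP hy hb, hL']
  ring

end Fields

/-! ### §C  Calculus along the plane: constancy of `η` in `t` and the separation of `Qu` -/

/-- **One-dimensional constancy**: a function with zero derivative on a closed segment takes the same value at its ends. [folklore] -/
theorem eq_of_hasDerivAt_zero {f : ℝ → ℝ} {a c : ℝ} (h : ∀ t ∈ uIcc a c, HasDerivAt f 0 t) : f c = f a := by
  rcases lt_trichotomy a c with hlt | heq | hgt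
  · have hcont : ContinuousOn f (Icc a c) := fun t ht => (h t (by rw [uIcc_of_le hlt.le]; exact ht)).continuousAt.continuousWithinAt
    obtain ⟨ξ, -, hξ⟩ := exists_hasDerivAt_eq_slope f (fun _ => (0 : ℝ)) hlt hcont
      (fun t ht => h t (by rw [uIcc_of_le hlt.le]; exact Ioo_subset_Icc_self ht))
    have hne : c - a ≠ 0 := sub_ne_zero.mpr (ne_of_gt hlt)
    have := hξ.symm
    rw [div_eq_zero_iff] at this
    rcases this with h0 | h0
    · linarith
    · exact absurd h0 hne
  · rw [heq]
  · have hcont : ContinuousOn f (Icc c a) := fun t ht => (h t (by rw [uIcc_of_ge hgt.le]; exact ht)).continuousAt.continuousWithinAt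
    obtain ⟨ξ, -, hξ⟩ := exists_hasDerivAt_eq_slope f (fun _ => (0 : ℝ)) hgt hcont
      (fun t ht => h t (by rw [uIcc_of_ge hgt.le]; exact Ioo_subset_Icc_self ht))
    have hne : a - c ≠ 0 := sub_ne_zero.mpr (ne_of_gt hgt)
    have := hξ.symm
    rw [div_eq_zero_iff] at this
    rcases this with h0 | h0
    · linarith
    · exact absurd h0 hne

section Plane

variable {w : EuclideanSpace ℝ (Fin 3) → ℝ} {P Λ : ℝ × ℝ → ℝ} {U : Set (EuclideanSpace ℝ (Fin 3))}
  {y₀ : EuclideanSpace ℝ (Fin 3)} {b : Fin 3} {ρ : ℝ}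

/-- **Vertical derivative of `Qu` along the plane.**  With `Y(t,z) = y₀ + t e_b + (z − (y₀)₂)e₂ ∈ U`:
`∂_z [Λ(p)∂_b w(Y)] = (Ld + Λ Pw)(p)·∂_b w(Y)`, `p = (w(Y), z)`. [folklore] -/
theorem hasDerivAt_Qu_z (hU : IsOpen U) (hw : ContDiff ℝ 2 w) (hb : b ≠ 2)
    (hPd : ∀ y ∈ U, DifferentiableAt ℝ P (w y, y 2)) (hΛd : ∀ y ∈ U, DifferentiableAt ℝ Λ (w y, y 2))
    (hP : ∀ y ∈ U, fderiv ℝ w y (EuclideanSpace.single 2 (1 : ℝ)) = P (w y, y 2)) {t z : ℝ}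
    (hY : y₀ + t • EuclideanSpace.single b (1 : ℝ) + (z - y₀ 2) • EuclideanSpace.single (2 : Fin 3) (1 : ℝ) ∈ U) :
    HasDerivAt (fun z' : ℝ => Λ (w (y₀ + t • EuclideanSpace.single b (1 : ℝ) + (z' - y₀ 2) • EuclideanSpace.single (2 : Fin 3) (1 : ℝ)), z') *
        fderiv ℝ w (y₀ + t • EuclideanSpace.single b (1 : ℝ) + (z' - y₀ 2) • EuclideanSpace.single (2 : Fin 3) (1 : ℝ))
          (EuclideanSpace.single b (1 : ℝ)))
      ((fderiv ℝ Λ (w (y₀ + t • EuclideanSpace.single b (1 : ℝ) + (z - y₀ 2) • EuclideanSpace.single (2 : Fin 3) (1 : ℝ)), z)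
            (P (w (y₀ + t • EuclideanSpace.single b (1 : ℝ) + (z - y₀ 2) • EuclideanSpace.single (2 : Fin 3) (1 : ℝ)), z), 1) +
          Λ (w (y₀ + t • EuclideanSpace.single b (1 : ℝ) + (z - y₀ 2) • EuclideanSpace.single (2 : Fin 3) (1 : ℝ)), z) *
            fderiv ℝ P (w (y₀ + t • EuclideanSpace.single b (1 : ℝ) + (z - y₀ 2) • EuclideanSpace.single (2 : Fin 3) (1 : ℝ)), z) (1, 0)) *
        fderiv ℝ w (y₀ + t • EuclideanSpace.single b (1 : ℝ) + (z - y₀ 2) • EuclideanSpace.single (2 : Fin 3) (1 : ℝ))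
          (EuclideanSpace.single b (1 : ℝ))) z := by
  have hwd : Differentiable ℝ w := hw.differentiable (by norm_num)
  set y₁ : EuclideanSpace ℝ (Fin 3) := y₀ + t • EuclideanSpace.single b (1 : ℝ) with hy₁
  have hy₁2 : y₁ 2 = y₀ 2 := foot_apply_two y₀ hb t
  -- the field `g = Λ∘leaf · ∂_b w` along the vertical line through `y₁`
  set g : EuclideanSpace ℝ (Fin 3) → ℝ := fun y' => Λ (w y', y' 2) * fderiv ℝ w y' (EuclideanSpace.single b (1 : ℝ)) with hg
  have hmem : y₁ + (z - y₁ 2) • EuclideanSpace.single (2 : Fin 3) (1 : ℝ) ∈ U := by rw [hy₁2]; exact hY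
  have hgd : DifferentiableAt ℝ g (y₁ + (z - y₁ 2) • EuclideanSpace.single (2 : Fin 3) (1 : ℝ)) :=
    (differentiableAt_leaf_comp (hΛd _ hmem) (hwd _)).mul (differentiableAt_partial hw _ _)
  have hline := hasDerivAt_vertical_line (g := g) y₁ hgd
  rw [fderiv_vert_Qu hU hw hPd hΛd hP hmem hb, vline_apply_two] at hline
  have e : (fun ζ' : ℝ => g (y₁ + (ζ' - y₁ 2) • EuclideanSpace.single (2 : Fin 3) (1 : ℝ))) =
      fun z' : ℝ => Λ (w (y₀ + t • EuclideanSpace.single b (1 : ℝ) + (z' - y₀ 2) • EuclideanSpace.single (2 : Fin 3) (1 : ℝ)), z') *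
        fderiv ℝ w (y₀ + t • EuclideanSpace.single b (1 : ℝ) + (z' - y₀ 2) • EuclideanSpace.single (2 : Fin 3) (1 : ℝ))
          (EuclideanSpace.single b (1 : ℝ)) := by
    funext z'
    have h2 : (y₀ + t • EuclideanSpace.single b (1 : ℝ) + (z' - y₀ 2) • EuclideanSpace.single (2 : Fin 3) (1 : ℝ)) 2 = z' :=
      plane_apply_two y₀ hb t z'
    simp only [hg, hy₁, foot_apply_two y₀ hb t, h2]
  rw [e, hy₁2] at hline
  exact hline

/-- **Vertical derivative of `H` along the plane**: `∂_z [(1−Λ(p))∂_b w(Y)] = (−Ld + (1−Λ)Pw)(p)·∂_b w(Y)`. [folklore] -/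
theorem hasDerivAt_H_z (hU : IsOpen U) (hw : ContDiff ℝ 2 w) (hb : b ≠ 2)
    (hPd : ∀ y ∈ U, DifferentiableAt ℝ P (w y, y 2)) (hΛd : ∀ y ∈ U, DifferentiableAt ℝ Λ (w y, y 2))
    (hP : ∀ y ∈ U, fderiv ℝ w y (EuclideanSpace.single 2 (1 : ℝ)) = P (w y, y 2)) {t z : ℝ}
    (hY : y₀ + t • EuclideanSpace.single b (1 : ℝ) + (z - y₀ 2) • EuclideanSpace.single (2 : Fin 3) (1 : ℝ) ∈ U) :
    HasDerivAt (fun z' : ℝ => (1 - Λ (w (y₀ + t • EuclideanSpace.single b (1 : ℝ) + (z' - y₀ 2) • EuclideanSpace.single (2 : Fin 3) (1 : ℝ)), z')) *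
        fderiv ℝ w (y₀ + t • EuclideanSpace.single b (1 : ℝ) + (z' - y₀ 2) • EuclideanSpace.single (2 : Fin 3) (1 : ℝ))
          (EuclideanSpace.single b (1 : ℝ)))
      ((-(fderiv ℝ Λ (w (y₀ + t • EuclideanSpace.single b (1 : ℝ) + (z - y₀ 2) • EuclideanSpace.single (2 : Fin 3) (1 : ℝ)), z)
            (P (w (y₀ + t • EuclideanSpace.single b (1 : ℝ) + (z - y₀ 2) • EuclideanSpace.single (2 : Fin 3) (1 : ℝ)), z), 1)) +
          (1 - Λ (w (y₀ + t • EuclideanSpace.single b (1 : ℝ) + (z - y₀ 2) • EuclideanSpace.single (2 : Fin 3) (1 : ℝ)), z)) *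
            fderiv ℝ P (w (y₀ + t • EuclideanSpace.single b (1 : ℝ) + (z - y₀ 2) • EuclideanSpace.single (2 : Fin 3) (1 : ℝ)), z) (1, 0)) *
        fderiv ℝ w (y₀ + t • EuclideanSpace.single b (1 : ℝ) + (z - y₀ 2) • EuclideanSpace.single (2 : Fin 3) (1 : ℝ))
          (EuclideanSpace.single b (1 : ℝ))) z := by
  have hwd : Differentiable ℝ w := hw.differentiable (by norm_num)
  set y₁ : EuclideanSpace ℝ (Fin 3) := y₀ + t • EuclideanSpace.single b (1 : ℝ) with hy₁
  have hy₁2 : y₁ 2 = y₀ 2 := foot_apply_two y₀ hb t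
  set g : EuclideanSpace ℝ (Fin 3) → ℝ := fun y' => (1 - Λ (w y', y' 2)) * fderiv ℝ w y' (EuclideanSpace.single b (1 : ℝ)) with hg
  have hmem : y₁ + (z - y₁ 2) • EuclideanSpace.single (2 : Fin 3) (1 : ℝ) ∈ U := by rw [hy₁2]; exact hY
  have hgd : DifferentiableAt ℝ g (y₁ + (z - y₁ 2) • EuclideanSpace.single (2 : Fin 3) (1 : ℝ)) :=
    ((differentiableAt_const _).sub (differentiableAt_leaf_comp (hΛd _ hmem) (hwd _))).mul (differentiableAt_partial hw _ _)
  have hline := hasDerivAt_vertical_line (g := g) y₁ hgd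
  rw [fderiv_vert_H hU hw hPd hΛd hP hmem hb, vline_apply_two] at hline
  have e : (fun ζ' : ℝ => g (y₁ + (ζ' - y₁ 2) • EuclideanSpace.single (2 : Fin 3) (1 : ℝ))) =
      fun z' : ℝ => (1 - Λ (w (y₀ + t • EuclideanSpace.single b (1 : ℝ) + (z' - y₀ 2) • EuclideanSpace.single (2 : Fin 3) (1 : ℝ)), z')) *
        fderiv ℝ w (y₀ + t • EuclideanSpace.single b (1 : ℝ) + (z' - y₀ 2) • EuclideanSpace.single (2 : Fin 3) (1 : ℝ))
          (EuclideanSpace.single b (1 : ℝ)) := by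
    funext z'
    have h2 : (y₀ + t • EuclideanSpace.single b (1 : ℝ) + (z' - y₀ 2) • EuclideanSpace.single (2 : Fin 3) (1 : ℝ)) 2 = z' :=
      plane_apply_two y₀ hb t z'
    simp only [hg, hy₁, foot_apply_two y₀ hb t, h2]
  rw [e, hy₁2] at hline
  exact hline

/-- **Horizontal derivative of `w` along the plane**: `∂_t w(Y(t,z)) = ∂_b w(Y(t,z))`. [folklore] -/
theorem hasDerivAt_w_t (hw : ContDiff ℝ 2 w) (b : Fin 3) (y₀ : EuclideanSpace ℝ (Fin 3)) (t z : ℝ) :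
    HasDerivAt (fun t' : ℝ => w (y₀ + t' • EuclideanSpace.single b (1 : ℝ) + (z - y₀ 2) • EuclideanSpace.single (2 : Fin 3) (1 : ℝ)))
      (fderiv ℝ w (y₀ + t • EuclideanSpace.single b (1 : ℝ) + (z - y₀ 2) • EuclideanSpace.single (2 : Fin 3) (1 : ℝ))
        (EuclideanSpace.single b (1 : ℝ))) t := by
  have hwd : Differentiable ℝ w := hw.differentiable (by norm_num)
  have h := hasDerivAt_hline (g := w) (y₀ + (z - y₀ 2) • EuclideanSpace.single (2 : Fin 3) (1 : ℝ)) b (t := t) (hwd _)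
  have e : ∀ t' : ℝ, y₀ + (z - y₀ 2) • EuclideanSpace.single (2 : Fin 3) (1 : ℝ) + t' • EuclideanSpace.single b (1 : ℝ) =
      y₀ + t' • EuclideanSpace.single b (1 : ℝ) + (z - y₀ 2) • EuclideanSpace.single (2 : Fin 3) (1 : ℝ) := fun t' => by abel
  simp only [e] at h
  exact h

/-- **`η` is constant in `t` on the Branch-2b region.**  If `D₁ = 0` (brick F3a's Wronskian) at the plane points and `Λ ≠ 0` there, then
`t ↦ η(p(t,z)) = Pw(p) + Ld(p)/Λ(p)` has zero derivative (`∂_w η = D₁/Λ²`, brick F4-tr-c). [folklore] -/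
theorem hasDerivAt_eta_t_zero (hw : ContDiff ℝ 2 w) (b : Fin 3) (y₀ : EuclideanSpace ℝ (Fin 3)) {t z : ℝ}
    (hPc : ContDiffAt ℝ 2 P (w (y₀ + t • EuclideanSpace.single b (1 : ℝ) + (z - y₀ 2) • EuclideanSpace.single (2 : Fin 3) (1 : ℝ)), z))
    (hΛc : ContDiffAt ℝ 2 Λ (w (y₀ + t • EuclideanSpace.single b (1 : ℝ) + (z - y₀ 2) • EuclideanSpace.single (2 : Fin 3) (1 : ℝ)), z))
    (hL0 : Λ (w (y₀ + t • EuclideanSpace.single b (1 : ℝ) + (z - y₀ 2) • EuclideanSpace.single (2 : Fin 3) (1 : ℝ)), z) ≠ 0)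
    (hD1 : let y := y₀ + t • EuclideanSpace.single b (1 : ℝ) + (z - y₀ 2) • EuclideanSpace.single (2 : Fin 3) (1 : ℝ)
      Λ (w y, z) * (Λ (w y, z) * fderiv ℝ (fun q => fderiv ℝ P q ((1 : ℝ), (0 : ℝ))) (w y, z) (1, 0) +
            fderiv ℝ (fun q => fderiv ℝ Λ q ((1 : ℝ), (0 : ℝ))) (w y, z) (P (w y, z), 1) +
            2 * fderiv ℝ Λ (w y, z) (1, 0) * fderiv ℝ P (w y, z) (1, 0)) -
          fderiv ℝ Λ (w y, z) (1, 0) * (fderiv ℝ Λ (w y, z) (P (w y, z), 1) + Λ (w y, z) * fderiv ℝ P (w y, z) (1, 0)) = 0) :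
    HasDerivAt (fun t' : ℝ =>
        fderiv ℝ P (w (y₀ + t' • EuclideanSpace.single b (1 : ℝ) + (z - y₀ 2) • EuclideanSpace.single (2 : Fin 3) (1 : ℝ)), z) ((1 : ℝ), (0 : ℝ)) +
          fderiv ℝ Λ (w (y₀ + t' • EuclideanSpace.single b (1 : ℝ) + (z - y₀ 2) • EuclideanSpace.single (2 : Fin 3) (1 : ℝ)), z)
              (P (w (y₀ + t' • EuclideanSpace.single b (1 : ℝ) + (z - y₀ 2) • EuclideanSpace.single (2 : Fin 3) (1 : ℝ)), z), 1) /
            Λ (w (y₀ + t' • EuclideanSpace.single b (1 : ℝ) + (z - y₀ 2) • EuclideanSpace.single (2 : Fin 3) (1 : ℝ)), z))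
      0 t := by
  have hinner := hasDerivAt_w_t hw b y₀ t z
  have houter := hasDerivAt_eta hPc hΛc hL0
  have hcomp := houter.comp t hinner
  refine hcomp.congr_deriv ?_
  simp only at hD1
  have hL2 : Λ (w (y₀ + t • EuclideanSpace.single b (1 : ℝ) + (z - y₀ 2) • EuclideanSpace.single (2 : Fin 3) (1 : ℝ)), z) ^ 2 ≠ 0 :=
    pow_ne_zero 2 hL0
  rw [hD1, zero_div, zero_mul]

end Plane

end Summit.NavierStokesRegularity.NavierStokesRegularity.Theorems.PoloidalWindowDoorPoloidalWindowRigidityUntwistedStuartTranslation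

end
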